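import Mathlib
import Literature.Computability.AlgebraicComplexity.SymmetricArithCircuit
import HarnessLib

/-!
# The symmetric power chain: a symmetric circuit for `(Σ_x x)^(2^m)` by repeated squaring

Topic `Computability/AlgebraicComplexity`, namespace
`Literature.Computability.AlgebraicComplexity.PowerChainCircuit`.

Companion of `SymmetricArithCircuit.lean` (Dawar–Wilsenach symmetric arithmetic circuits:
`LabelledArithCircuit` = Def. 2.2, `IsAutomorphismExtending` = Def. 3.6,
`SymmetricArithmeticCircuit` = Def. 3.7 bundled).  For a finite set of variables `X` acted on by
a group `Γ` and `m : ℕ`, the **power chain** is the circuit with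

* inputs `inp x` (label `x`) and one constant gate `zero` (label `0`),
* the sum gate `sum = zero + Σ_x inp x` (the constant child keeps `sum` internal when `X = ∅`),
* for `k < m` a COPY gate `cp k = +{level k}` and a SQUARING gate `sq k = level k × cp k`
  (product gates of a `LabelledArithCircuit` take a SET of children, so squaring needs a twin of
  its argument), where `level 0 = sum` and `level (k + 1) = sq k` (`Gate.lvl`),

and output `level m`.  It is a `SymmetricArithmeticCircuit Γ` (`circuit`: `Γ` moves the inputs
as it moves `X` and fixes every other gate) on `|X| + 2m + 2` gates (`Gate.card_gate`), and
level `k` computes `(Σ_x x)^(2^k)` (`eval_lvl`, `eval_output`).  Its RIGIDITY (every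
automorphism extending `γ` is the action of `γ`, so that all orbits in the sense of
Dawar–Wilsenach §3.3 have size `≤ max |X| 1` in spite of the degree `2^m`) is in
`SymmetricPowerChainCircuitRigid.lean`.

Everything is proved; folklore (repeated squaring).  Consumer: route
`Summits/ValiantsHypothesis/…/Theses/MonotoneRestoration.lean`, crux `MonotoneRestorationQP`,
line Sketch v10 (the family `(Σ_ij x_ij)^(2^(2^n))` has square-symmetric circuits of orbit size
`≤ n²` but, by degree, none of quasi-polynomial SIZE: the `VP` hypothesis of the orbit
compression lemma is load-bearing).

What is NOT here: repeated squaring on top of an arbitrary symmetric circuit (the same gadget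
works verbatim; only the sum of the variables is needed downstream).
-/

noncomputable section

namespace Literature.Computability.AlgebraicComplexity

open MvPolynomial

universe u v w

namespace PowerChainCircuit

/-- Gates of the power chain over the variables `X` with `m` squaring levels: inputs `inp x`, the
constant `zero`, the sum `sum = 0 + Σ_x x` (level `0`), and for `k < m` the copy `cp k` of level
`k` and the square `sq k = level k × cp k` (level `k + 1`). [folklore] -/
inductive Gate (X : Type v) (m : ℕ) : Type v
  /-- Input gate for the variable `x`. -/
  | inp (x : X) : Gate X m
  /-- The constant gate `0` (a child of `sum`, so that `sum` is internal even for empty `X`). -/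
  | zero : Gate X m
  /-- The sum gate `0 + Σ_x x` (level `0`). -/
  | sum : Gate X m
  /-- The copy `+{level k}` of level `k`. -/
  | cp (k : Fin m) : Gate X m
  /-- The squaring gate `level k × cp k` (level `k + 1`). -/
  | sq (k : Fin m) : Gate X m
  deriving DecidableEq

variable {X : Type v} {m : ℕ}

namespace Gate

/-- The gates, as a sum type. [folklore] -/
def equivSum (X : Type v) (m : ℕ) : Gate X m ≃ X ⊕ Bool ⊕ Fin m ⊕ Fin m where
  toFun
    | inp x => Sum.inl x
    | zero => Sum.inr (Sum.inl false)
    | sum => Sum.inr (Sum.inl true)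
    | cp k => Sum.inr (Sum.inr (Sum.inl k))
    | sq k => Sum.inr (Sum.inr (Sum.inr k))
  invFun
    | Sum.inl x => inp x
    | Sum.inr (Sum.inl false) => zero
    | Sum.inr (Sum.inl true) => sum
    | Sum.inr (Sum.inr (Sum.inl k)) => cp k
    | Sum.inr (Sum.inr (Sum.inr k)) => sq k
  left_inv g := by cases g <;> rfl
  right_inv s := by rcases s with x | (_ | _) | k | k <;> rfl

/-- The gates of the power chain over finitely many variables form a finite type. [folklore] -/
instance instFintype [Fintype X] : Fintype (Gate X m) := Fintype.ofEquiv _ (equivSum X m).symm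

/-- The power chain has `|X| + 2m + 2` gates. [folklore] -/
theorem card_gate [Fintype X] : Fintype.card (Gate X m) = Fintype.card X + 2 * m + 2 := by
  rw [Fintype.card_congr (equivSum X m)]
  simp only [Fintype.card_sum, Fintype.card_bool, Fintype.card_fin]
  ring

/-- The level-`k` gate (`k ≤ m`): `sum` for `k = 0`, `sq j` for `k = j + 1`. [folklore] -/
def lvl : Fin (m + 1) → Gate X m := Fin.cases sum sq

/-- Level `0` is the sum gate. [folklore] -/
@[simp] theorem lvl_zero : (lvl 0 : Gate X m) = sum := Fin.cases_zero

/-- Level `j + 1` is the `j`-th square. [folklore] -/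
@[simp] theorem lvl_succ (j : Fin m) : (lvl j.succ : Gate X m) = sq j := Fin.cases_succ _

/-- A level gate is not a copy gate. [folklore] -/
theorem lvl_ne_cp (k : Fin (m + 1)) (j : Fin m) : (lvl k : Gate X m) ≠ cp j := by
  cases k using Fin.cases <;> simp

/-- A level gate is not the constant gate. [folklore] -/
theorem lvl_ne_zero (k : Fin (m + 1)) : (lvl k : Gate X m) ≠ zero := by
  cases k using Fin.cases <;> simp

/-- A level gate is not an input gate. [folklore] -/
theorem lvl_ne_inp (k : Fin (m + 1)) (x : X) : (lvl k : Gate X m) ≠ inp x := by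
  cases k using Fin.cases <;> simp

/-- `lvl` is injective. [folklore] -/
theorem lvl_injective : Function.Injective (lvl : Fin (m + 1) → Gate X m) := by
  intro a b h
  cases a using Fin.cases <;> cases b using Fin.cases <;> simp_all

/-- Rank of a gate (inputs and the constant `0`, the sum `1`, `cp k ↦ 2k + 2`, `sq k ↦ 2k + 3`),
used for acyclicity. [folklore] -/
def rank : Gate X m → ℕ
  | inp _ => 0
  | zero => 0
  | sum => 1
  | cp k => 2 * k + 2
  | sq k => 2 * k + 3

/-- The level-`k` gate has rank `2k + 1`. [folklore] -/
theorem rank_lvl (k : Fin (m + 1)) : rank (lvl k : Gate X m) = 2 * k + 1 := by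
  cases k using Fin.cases with
  | zero => simp [rank]
  | succ j => simp only [lvl_succ, rank, Fin.val_succ]; ring

section Action

variable {Γ : Type w} [Group Γ] [MulAction Γ X]

/-- `Γ` acts on the gates by moving the inputs as it moves the variables and fixing every other
gate. [folklore] -/
instance instMulAction : MulAction Γ (Gate X m) where
  smul γ
    | inp x => inp (γ • x)
    | zero => zero
    | sum => sum
    | cp k => cp k
    | sq k => sq k
  one_smul g := by
    cases g with
    | inp x => exact congrArg inp (one_smul Γ x)
    | zero => rfl
    | sum => rfl
    | cp k => rfl
    | sq k => rfl
  mul_smul γ γ' g := by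
    cases g with
    | inp x => exact congrArg inp (mul_smul γ γ' x)
    | zero => rfl
    | sum => rfl
    | cp k => rfl
    | sq k => rfl

/-- The action on input gates. [folklore] -/
@[simp] theorem smul_inp (γ : Γ) (x : X) : γ • (inp x : Gate X m) = inp (γ • x) := rfl

/-- The constant gate is fixed. [folklore] -/
@[simp] theorem smul_zero_eq (γ : Γ) : γ • (zero : Gate X m) = zero := rfl

/-- The sum gate is fixed. [folklore] -/
@[simp] theorem smul_sum (γ : Γ) : γ • (sum : Gate X m) = sum := rfl

/-- Copy gates are fixed. [folklore] -/
@[simp] theorem smul_cp (γ : Γ) (k : Fin m) : γ • (cp k : Gate X m) = cp k := rfl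

/-- Squaring gates are fixed. [folklore] -/
@[simp] theorem smul_sq (γ : Γ) (k : Fin m) : γ • (sq k : Gate X m) = sq k := rfl

/-- Level gates are fixed. [folklore] -/
@[simp] theorem smul_lvl (γ : Γ) (k : Fin (m + 1)) : γ • (lvl k : Gate X m) = lvl k := by
  cases k using Fin.cases <;> simp

end Action

variable [Fintype X] [DecidableEq X]

/-- Children in the power chain: `sum ← {zero} ∪ inputs`, `cp k ← {level k}`,
`sq k ← {level k, cp k}`. [folklore] -/
def children : Gate X m → Finset (Gate X m)
  | inp _ => ∅
  | zero => ∅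
  | sum => insert zero (Finset.univ.image inp)
  | cp k => {lvl k.castSucc}
  | sq k => {lvl k.castSucc, cp k}

/-- Labels in the power chain. [folklore] -/
def label (K : Type u) [Zero K] : Gate X m → CircuitLabel K X
  | inp x => .var x
  | zero => .const 0
  | sum => .add
  | cp _ => .add
  | sq _ => .mul

/-- Children have smaller rank. [folklore] -/
theorem rank_lt_of_mem_children {g h : Gate X m} (hh : h ∈ children g) : rank h < rank g := by
  cases g with
  | inp x => simp [children] at hh
  | zero => simp [children] at hh
  | sum =>
    simp only [children, Finset.mem_insert, Finset.mem_image, Finset.mem_univ, true_and] at hh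
    rcases hh with rfl | ⟨x, rfl⟩ <;> simp [rank]
  | cp k =>
    simp only [children, Finset.mem_singleton] at hh
    subst hh
    rw [rank_lvl]; simp [rank]
  | sq k =>
    simp only [children, Finset.mem_insert, Finset.mem_singleton] at hh
    rcases hh with rfl | rfl
    · rw [rank_lvl]; simp [rank]
    · simp [rank]

/-- `zero` is a child of `sum` only. [folklore] -/
theorem eq_sum_of_zero_mem_children {g : Gate X m} (h : zero ∈ children g) : g = sum := by
  cases g with
  | inp x => simp [children] at h
  | zero => simp [children] at h
  | sum => rfl
  | cp k => simp only [children, Finset.mem_singleton] at h; exact absurd h.symm (lvl_ne_zero _)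
  | sq k =>
    simp only [children, Finset.mem_insert, Finset.mem_singleton, reduceCtorEq, or_false] at h
    exact absurd h.symm (lvl_ne_zero _)

/-- `cp k` is a child of `sq k` only. [folklore] -/
theorem eq_sq_of_cp_mem_children {g : Gate X m} {k : Fin m} (h : cp k ∈ children g) :
    g = sq k := by
  cases g with
  | inp x => simp [children] at h
  | zero => simp [children] at h
  | sum => simp [children] at h
  | cp j => simp only [children, Finset.mem_singleton] at h; exact absurd h.symm (lvl_ne_cp _ _)
  | sq j =>
    simp only [children, Finset.mem_insert, Finset.mem_singleton, cp.injEq] at h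
    rcases h with h | rfl
    · exact absurd h.symm (lvl_ne_cp _ _)
    · rfl

/-- `cp k` is the only addition gate with children `{level k}`. [folklore] -/
theorem eq_cp_of_children_eq (K : Type u) [Zero K] {g : Gate X m} {k : Fin m}
    (hc : children g = {lvl k.castSucc}) (hl : label K g = .add) : g = cp k := by
  cases g with
  | inp x => simp [label] at hl
  | zero => simp [label] at hl
  | sum =>
    have h0 : (zero : Gate X m) ∈ children (sum : Gate X m) := by simp [children]
    rw [hc, Finset.mem_singleton] at h0
    exact absurd h0.symm (lvl_ne_zero _)
  | cp j =>
    have hj : (lvl j.castSucc : Gate X m) ∈ children (cp j : Gate X m) := by simp [children]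
    rw [hc, Finset.mem_singleton] at hj
    rw [Fin.castSucc_injective _ (lvl_injective hj)]
  | sq j => simp [label] at hl

end Gate

open Gate

section Circuit

variable (K : Type u) [Zero K] (Γ : Type w) [Group Γ] (X : Type v) [Fintype X] [DecidableEq X]
  [MulAction Γ X] (m : ℕ)

/-- **The symmetric power chain**: the `Γ`-symmetric arithmetic circuit `zero, inp x → sum →
(cp 0, sq 0) → ⋯ → (cp (m-1), sq (m-1))` with output the level-`m` gate, computing
`(Σ_x x)^(2^m)` (`eval_output`) on `|X| + 2m + 2` gates with orbit size `≤ max |X| 1`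
(`orbitSize_le`). [folklore] -/
def circuit : SymmetricArithmeticCircuit Γ K X Unit (Gate X m) where
  children := children
  label := label K
  output _ := lvl (Fin.last m)
  wf := Subrelation.wf (fun {_ _} hh => rank_lt_of_mem_children hh)
    (InvImage.wf rank Nat.lt_wfRel.wf)
  isInput_iff g := by
    cases g with
    | inp x => simp [label, children]
    | zero => simp [label, children]
    | sum => simp [label, children]
    | cp k => simp [label, children]
    | sq k => simp [label, children]
  eq_of_label_eq g g' hg hl := by
    cases g with
    | inp x => cases g' <;> simp_all [label]
    | zero => cases g' <;> simp_all [label]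
    | sum => simp [label] at hg
    | cp k => simp [label] at hg
    | sq k => simp [label] at hg
  output_injective := fun _ _ _ => rfl
  children_smul γ g := by
    cases g with
    | inp x => simp [children]
    | zero => simp [children]
    | sum =>
      ext h
      simp only [smul_sum, children, Finset.mem_insert, Finset.mem_image, Finset.mem_univ,
        true_and, Finset.mem_map, Equiv.toEmbedding_apply, MulAction.toPerm_apply]
      constructor
      · rintro (rfl | ⟨x, rfl⟩)
        · exact ⟨zero, Or.inl rfl, rfl⟩
        · exact ⟨inp (γ⁻¹ • x), Or.inr ⟨γ⁻¹ • x, rfl⟩, by simp⟩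
      · rintro ⟨h', rfl | ⟨x, rfl⟩, rfl⟩
        · exact Or.inl rfl
        · exact Or.inr ⟨γ • x, rfl⟩
    | cp k => simp [children]
    | sq k => simp [children, Finset.map_insert]
  label_smul γ g := by cases g <;> rfl
  output_smul _ _ := by simp

variable {K Γ X m}

/-- The children of the power chain, unfolded. [folklore] -/
theorem circuit_children (g : Gate X m) : (circuit K Γ X m).children g = children g := rfl

/-- The labels of the power chain, unfolded. [folklore] -/
theorem circuit_label (g : Gate X m) : (circuit K Γ X m).label g = label K g := rfl

/-- The output of the power chain is the level-`m` gate. [folklore] -/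
theorem circuit_output (y : Unit) : (circuit K Γ X m).output y = lvl (Fin.last m) := rfl

end Circuit

/-! ### Evaluation: level `k` computes `(Σ_x x)^(2^k)` -/

section Eval

variable {K : Type u} [CommSemiring K] {Γ : Type w} [Group Γ] [Fintype X] [DecidableEq X]
  [MulAction Γ X]

/-- The sum gate computes `Σ_x x`. [folklore] -/
theorem eval_sum : (circuit K Γ X m).eval sum = ∑ x : X, MvPolynomial.X x := by
  rw [(circuit K Γ X m).eval_of_label_add (g := sum) rfl, circuit_children, children,
    Finset.sum_insert (by simp), Finset.sum_image fun x _ y _ h => by simpa using h,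
    (circuit K Γ X m).eval_of_label_const (g := zero) (c := 0) rfl, map_zero, zero_add]
  exact Finset.sum_congr rfl fun x _ => (circuit K Γ X m).eval_of_label_var (g := inp x) rfl

/-- A copy gate computes what its level computes. [folklore] -/
theorem eval_cp (k : Fin m) : (circuit K Γ X m).eval (cp k) = (circuit K Γ X m).eval (lvl k.castSucc) := by
  rw [(circuit K Γ X m).eval_of_label_add (g := cp k) rfl, circuit_children, children,
    Finset.sum_singleton]

/-- A squaring gate computes the square of its level. [folklore] -/
theorem eval_sq (k : Fin m) :
    (circuit K Γ X m).eval (sq k) = (circuit K Γ X m).eval (lvl k.castSucc) ^ 2 := by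
  rw [(circuit K Γ X m).eval_of_label_mul (g := sq k) rfl, circuit_children, children,
    Finset.prod_pair (lvl_ne_cp _ _), eval_cp, pow_two]

/-- **Level `k` computes `(Σ_x x)^(2^k)`.** [folklore] -/
theorem eval_lvl (k : Fin (m + 1)) :
    (circuit K Γ X m).eval (lvl k) = (∑ x : X, MvPolynomial.X x) ^ (2 ^ (k : ℕ)) := by
  induction k using Fin.induction with
  | zero => simp [eval_sum]
  | succ k ih => rw [lvl_succ, eval_sq, ih, ← pow_mul, Fin.val_succ, pow_succ]; rfl

/-- **The power chain computes `(Σ_x x)^(2^m)`.** [folklore] -/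
theorem eval_output :
    (circuit K Γ X m).eval ((circuit K Γ X m).output ()) = (∑ x : X, MvPolynomial.X x) ^ (2 ^ m) := by
  rw [circuit_output, eval_lvl, Fin.val_last]

end Eval

end PowerChainCircuit

end Literature.Computability.AlgebraicComplexity

end
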